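import Summits.ValiantsHypothesis.ValiantsHypothesis.Theorems.BarrierLeverAnchoredDoorHitsLowerPairsThinStepSpec

/-!
# Support item `AnchoredDoorHitsLowerPairs` (stmt-ValiantsHypothesis-22510), line `anchored-peeling`:
# THIN VERTEX STEP, part 3 — degrees, top coefficients, and the ALIGNED thin vertex step

Helper file towards the registered open stub `stub_vertexStep` of the skeleton
`Cruxes/AnchoredDoorHitsLowerPairs/Lines/anchored_peeling.lean` (v5; planner valiant-natproofs-p1 g19, D-0145; lane val-np-p2).
Cell valiant-natproofs, rung V4, 𝒟-side door (c); prover seat val-np-p2 gen 11. Closes NO item (`--supports stmt-ValiantsHypothesis-22510`).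

**THEOREM (`symbolicDet_ne_zero_of_thinDesign`, the aligned thin vertex step; every profile `s ≥ 1`, every `h`).** Let `(u, w)` be a
layout, `a` an `x`-vertex, and suppose the LINK ROWS `i` (those with `a ∈ u i`) carry a DESIGN: a set `D` of `y`-vertices with link
faces `Sx c ∌ a`, pairwise distinct, and columns `τ c ∋ c`, such that every link row `i` is `Sx c ∪ {a}` for some `c ∈ D` with
`τ c = w i` (its OWN column is its designated top column), `w` injective. If the DELETION BLOCK (rows and columns `i` with `a ∉ u i`)
of the symbolic layout matrix is nonsingular, then `symbolicDet s h r u w ≠ 0`.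
PROOF. Under the designed specialisation of part 2 with scale `N = h`, a link row `i` has `T`-degree `≤ N(h + |u i ∖ a|) + |w i| − 1`
(`natDegree_linkEntry_le`), attained ONLY in its own column, with top coefficient `1` (`coeff_linkEntry_top`: the competing terms lose
either a factor `T^N` — another design vertex `c`, whose link face meets `u i ∖ a` in a proper subset, or a missing `x`-twist — or a
`y`-twist; the surviving coefficient is `[y^{w j ∖ w i}] F₀ = [w j ⊆ w i]` by part 1); deletion rows are constants. So the top
`T`-coefficient matrix of the specialised minor is block-triangular with an identity block on the link rows and the deletion block
on the rest (`Matrix.twoBlockTriangular_det'`), and the top coefficient of `thinHom (symbolicDet)` is `± det(deletion block) ≠ 0`.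
Part 4 removes the alignment (column permutation + the combinatorics of upper systems of distinct representatives) and states the
step in the exact shape of `Stmt.stub_vertexStep` under the single side condition `|St_a R| ≤ f₀(C)`.

WHAT THIS IS NOT: no statement about items 22510 / 19717 themselves; nothing on crux stmt-ValiantsHypothesis-14610 or on `VP` versus `VNP`.
-/

set_option linter.dupNamespace false

namespace Summit.ValiantsHypothesis.ValiantsHypothesis.Theorems.BarrierLever.AnchoredPeeling

open Finset MvPolynomial
open Summit.ValiantsHypothesis.ValiantsHypothesis.Theorems.BarrierLever.BrickCalculus
  (pexpo pexpo_def pexpo_le_iff pexpo_sub pexpo_apply_castAdd pexpo_apply_natAdd)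

noncomputable section

namespace ThinStep

variable {h : ℕ}

/-! ## 1. Arithmetic of the designed exponents -/

section Arith

/-- The top exponent is reached by the full term of the row's own design vertex. -/
theorem exp_top_eq {N hh s t : ℕ} (hs : s ≤ hh) :
    N * (hh - s) + 2 * N * s + (t - 1) = N * (hh + s) + (t - 1) := by
  have : N * (hh - s) + 2 * N * s = N * (hh + s) := by
    rw [show hh + s = (hh - s) + 2 * s by omega, Nat.mul_add]; ring
  rw [this]

/-- Every term of the row's own design vertex stays below the top exponent. -/
theorem exp_le_top {N hh s z w t : ℕ} (hs : s ≤ hh) (hz : z ≤ s) (hw : w ≤ t - 1) :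
    N * (hh - s) + 2 * N * z + w ≤ N * (hh + s) + (t - 1) := by
  have h1 : 2 * N * z ≤ 2 * N * s := Nat.mul_le_mul_left _ hz
  calc N * (hh - s) + 2 * N * z + w ≤ N * (hh - s) + 2 * N * s + (t - 1) := by omega
    _ = N * (hh + s) + (t - 1) := exp_top_eq hs

/-- A term losing a factor `T^N` (wrong design vertex, or a missing `x`-twist) stays STRICTLY below `N (hh + s)`. -/
theorem exp_lt_of_loss {N hh s s' z w : ℕ} (hs' : s' ≤ hh) (hz : 2 * z + 1 ≤ s' + s) (hw : w < N) :
    N * (hh - s') + 2 * N * z + w < N * (hh + s) := by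
  have h1 : hh - s' + 2 * z + 1 ≤ hh + s := by omega
  calc N * (hh - s') + 2 * N * z + w < N * (hh - s') + 2 * N * z + N := by omega
    _ = N * (hh - s' + 2 * z + 1) := by ring
    _ ≤ N * (hh + s) := Nat.mul_le_mul_left _ h1

/-- Two distinct finsets containing `Z` have `2|Z| + 1 ≤ |A| + |B|`. -/
theorem two_mul_card_add_one_le {α : Type*} [DecidableEq α] {A B Z : Finset α} (hne : A ≠ B) (hZA : Z ⊆ A) (hZB : Z ⊆ B) :
    2 * Z.card + 1 ≤ A.card + B.card := by
  have hZ : Z ⊆ A ∩ B := Finset.subset_inter hZA hZB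
  have hle : Z.card ≤ (A ∩ B).card := Finset.card_le_card hZ
  have hA : (A ∩ B).card ≤ A.card := Finset.card_le_card Finset.inter_subset_left
  have hB : (A ∩ B).card ≤ B.card := Finset.card_le_card Finset.inter_subset_right
  by_cases hAe : A ∩ B = A
  · have hBlt : (A ∩ B).card < B.card := by
      refine Finset.card_lt_card (lt_of_le_of_ne Finset.inter_subset_right (fun hBe => hne ?_))
      rw [← hAe]; nth_rw 2 [← hBe]
    omega
  · have hAlt : (A ∩ B).card < A.card :=
      Finset.card_lt_card (lt_of_le_of_ne Finset.inter_subset_left hAe)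
    omega

end Arith

/-! ## 2. The link-row entry: degree and top coefficient -/

variable (a : Fin h) (D : Finset (Fin h)) (Sx τ : Fin h → Finset (Fin h)) (N : ℕ)

/-- The link-row entry of part 2 (`coeff_map_thinHom_of_mem`), as a function of the row face `U ∋ a` and the column face `W'`. -/
def linkEntry (s : ℕ) (U W' : Finset (Fin h)) : Polynomial (MvPolynomial (Param h) ℂ) :=
  ∑ c ∈ D, ∑ Z ∈ (Sx c).powerset, ∑ W ∈ ((τ c).erase c).powerset,
    if Z ⊆ U.erase a ∧ insert c W ⊆ W' then
      Polynomial.monomial (N * (h - (Sx c).card) + 2 * N * Z.card + W.card)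
        (coeff (pexpo (U.erase a \ Z) (W' \ insert c W)) (killVars {Fin.castAdd h a} (symbolicWitness s h)))
    else 0

/-- Part 2's link-row entry formula, named. -/
theorem coeff_map_thinHom_eq_linkEntry {s : ℕ} (hs : 1 ≤ s) (hD : ∀ c ∈ D, a ∉ Sx c) {U : Finset (Fin h)}
    (W' : Finset (Fin h)) (haU : a ∈ U) :
    coeff (pexpo U W') (MvPolynomial.map (thinHom a D Sx τ N) (symbolicWitness s h)) = linkEntry a D Sx τ N s U W' := by
  rw [coeff_map_thinHom_of_mem a D Sx τ N hs hD W' haU]; rfl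

/-- The top exponent of a link row with link face of size `sz` and own column of size `t`. -/
def topExp (N hh sz t : ℕ) : ℕ := N * (hh + sz) + (t - 1)

variable {a D Sx τ N}

/-- **Degree bound.** With `h ≤ N`, link faces pairwise distinct on `D`, and the row `U = Sx c₀ ∪ {a}` (`c₀ ∈ D`): every term of
`linkEntry U W'` has degree `≤ topExp N h |U ∖ a| |τ c₀|`. -/
theorem natDegree_linkEntry_le (s : ℕ) (hN : h ≤ N) (hinj : ∀ c ∈ D, ∀ c' ∈ D, Sx c = Sx c' → c = c')
    (hτ : ∀ c ∈ D, c ∈ τ c) {c₀ : Fin h} (hc₀ : c₀ ∈ D) {U : Finset (Fin h)} (hU : Sx c₀ = U.erase a) (W' : Finset (Fin h)) :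
    (linkEntry a D Sx τ N s U W').natDegree ≤ topExp N h (U.erase a).card (τ c₀).card := by
  classical
  have hpos : 0 < h := Fin.pos a
  rw [linkEntry]
  refine Polynomial.natDegree_sum_le_of_forall_le _ _ (fun c hc => ?_)
  refine Polynomial.natDegree_sum_le_of_forall_le _ _ (fun Z hZ => ?_)
  refine Polynomial.natDegree_sum_le_of_forall_le _ _ (fun W hW => ?_)
  split_ifs with hcond
  · refine (Polynomial.natDegree_monomial_le _).trans ?_
    have hZc : Z ⊆ Sx c := Finset.mem_powerset.mp hZ
    have hWc : W ⊆ (τ c).erase c := Finset.mem_powerset.mp hW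
    have hSxle : (Sx c).card ≤ h := (Finset.card_le_univ _).trans (by rw [Fintype.card_fin])
    have hτle : (τ c).card ≤ h := (Finset.card_le_univ _).trans (by rw [Fintype.card_fin])
    have hWcard : W.card ≤ (τ c).card - 1 := by
      have := Finset.card_le_card hWc
      rw [Finset.card_erase_of_mem (hτ c hc)] at this
      exact this
    by_cases hcc : c = c₀
    · subst hcc
      rw [topExp, ← hU]
      exact exp_le_top hSxle (Finset.card_le_card hZc) hWcard
    · have hne : Sx c ≠ U.erase a := fun heq => hcc (hinj c hc c₀ hc₀ (heq.trans hU.symm))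
      have hwN : W.card < N := by omega
      have hlt := exp_lt_of_loss (N := N) (hh := h) (s := (U.erase a).card) (s' := (Sx c).card) (z := Z.card)
        (w := W.card) hSxle (two_mul_card_add_one_le hne hZc hcond.1) hwN
      rw [topExp]
      omega
  · rw [Polynomial.natDegree_zero]; exact Nat.zero_le _

/-- **Top coefficient.** In the same situation the coefficient of `T^{topExp}` in `linkEntry U W'` is `[W' = τ c₀]`. -/
theorem coeff_linkEntry_top (s : ℕ) (hN : h ≤ N) (hinj : ∀ c ∈ D, ∀ c' ∈ D, Sx c = Sx c' → c = c')
    (hτ : ∀ c ∈ D, c ∈ τ c) {c₀ : Fin h} (hc₀ : c₀ ∈ D) {U : Finset (Fin h)} (hU : Sx c₀ = U.erase a) (W' : Finset (Fin h)) :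
    (linkEntry a D Sx τ N s U W').coeff (topExp N h (U.erase a).card (τ c₀).card) = if W' = τ c₀ then 1 else 0 := by
  classical
  have hpos : 0 < h := Fin.pos a
  have hSle : ∀ c, (Sx c).card ≤ h := fun c => (Finset.card_le_univ _).trans (by rw [Fintype.card_fin])
  have hτle : ∀ c, (τ c).card ≤ h := fun c => (Finset.card_le_univ _).trans (by rw [Fintype.card_fin])
  -- a generic vanishing criterion for the terms
  have hvan : ∀ (c : Fin h) (Z W : Finset (Fin h)) (q : MvPolynomial (Param h) ℂ),
      N * (h - (Sx c).card) + 2 * N * Z.card + W.card < topExp N h (U.erase a).card (τ c₀).card →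
      (if Z ⊆ U.erase a ∧ insert c W ⊆ W' then
        Polynomial.monomial (N * (h - (Sx c).card) + 2 * N * Z.card + W.card) q else 0).coeff
          (topExp N h (U.erase a).card (τ c₀).card) = 0 := by
    intro c Z W q hlt
    split_ifs
    · rw [Polynomial.coeff_monomial, if_neg (Nat.ne_of_lt hlt)]
    · rw [Polynomial.coeff_zero]
  rw [linkEntry, Polynomial.finsetSum_coeff, Finset.sum_eq_single c₀]
  · -- the own design vertex: single out `Z = Sx c₀` and `W = τ c₀ ∖ c₀`
    rw [Polynomial.finsetSum_coeff, Finset.sum_eq_single (Sx c₀)]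
    · rw [Polynomial.finsetSum_coeff, Finset.sum_eq_single ((τ c₀).erase c₀)]
      · have htop : N * (h - (Sx c₀).card) + 2 * N * (Sx c₀).card + ((τ c₀).erase c₀).card =
            topExp N h (U.erase a).card (τ c₀).card := by
          rw [Finset.card_erase_of_mem (hτ c₀ hc₀), topExp, ← hU]
          exact exp_top_eq (hSle c₀)
        rw [Finset.insert_erase (hτ c₀ hc₀)]
        by_cases hsub : τ c₀ ⊆ W'
        · rw [if_pos ⟨hU.le, hsub⟩, htop, Polynomial.coeff_monomial, if_pos rfl, ← hU, Finset.sdiff_self,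
            coeff_killVars_symbolicWitness_xfree]
          by_cases heq : W' = τ c₀
          · rw [if_pos heq, if_pos (Finset.sdiff_eq_empty_iff_subset.mpr heq.le)]
          · rw [if_neg heq, if_neg (fun h0 => heq (Finset.Subset.antisymm (Finset.sdiff_eq_empty_iff_subset.mp h0) hsub))]
        · rw [if_neg (fun h' => hsub h'.2), Polynomial.coeff_zero, if_neg]
          rintro rfl
          exact hsub subset_rfl
      · intro W hW hWne
        apply hvan
        have hWlt : W.card < ((τ c₀).erase c₀).card :=
          Finset.card_lt_card (lt_of_le_of_ne (Finset.mem_powerset.mp hW) hWne)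
        rw [Finset.card_erase_of_mem (hτ c₀ hc₀)] at hWlt
        rw [topExp, ← hU, ← exp_top_eq (N := N) (t := (τ c₀).card) (hSle c₀)]
        omega
      · intro hnot
        exact absurd (Finset.mem_powerset.mpr subset_rfl) hnot
    · intro Z hZ hZne
      rw [Polynomial.finsetSum_coeff]
      refine Finset.sum_eq_zero (fun W hW => hvan _ _ _ _ ?_)
      have hZlt : Z.card < (Sx c₀).card := Finset.card_lt_card (lt_of_le_of_ne (Finset.mem_powerset.mp hZ) hZne)
      have hWle : W.card ≤ (τ c₀).card - 1 := by
        have := Finset.card_le_card (Finset.mem_powerset.mp hW)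
        rwa [Finset.card_erase_of_mem (hτ c₀ hc₀)] at this
      have hτc₀ := hτle c₀
      have h2 : 2 * Z.card + 1 ≤ (Sx c₀).card + (U.erase a).card := by rw [← hU]; omega
      have hwN : W.card < N := by omega
      have hlt := exp_lt_of_loss (N := N) (hh := h) (s := (U.erase a).card) (s' := (Sx c₀).card) (z := Z.card)
        (w := W.card) (hSle c₀) h2 hwN
      rw [topExp]; omega
    · intro hnot
      exact absurd (Finset.mem_powerset.mpr subset_rfl) hnot
  · -- another design vertex: every term loses a factor `T^N`
    intro c hc hcc
    rw [Polynomial.finsetSum_coeff]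
    refine Finset.sum_eq_zero (fun Z hZ => ?_)
    rw [Polynomial.finsetSum_coeff]
    refine Finset.sum_eq_zero (fun W hW => ?_)
    by_cases hcond : Z ⊆ U.erase a ∧ insert c W ⊆ W'
    · apply hvan
      have hne : Sx c ≠ U.erase a := fun heq => hcc (hinj c hc c₀ hc₀ (heq.trans hU.symm))
      have hWle : W.card ≤ (τ c).card - 1 := by
        have := Finset.card_le_card (Finset.mem_powerset.mp hW)
        rwa [Finset.card_erase_of_mem (hτ c hc)] at this
      have hτc := hτle c
      have hwN : W.card < N := by omega
      have hlt := exp_lt_of_loss (N := N) (hh := h) (s := (U.erase a).card) (s' := (Sx c).card) (z := Z.card)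
        (w := W.card) (hSle c) (two_mul_card_add_one_le hne (Finset.mem_powerset.mp hZ) hcond.1) hwN
      rw [topExp]; omega
    · rw [if_neg hcond, Polynomial.coeff_zero]
  · intro hnot
    exact absurd hc₀ hnot

/-! ## 3. The aligned thin vertex step -/

/-- **The aligned thin vertex step** (see the module docstring). -/
theorem symbolicDet_ne_zero_of_thinDesign (s h r : ℕ) (hs : 1 ≤ s) (u w : Fin r → Finset (Fin h))
    (hw : Function.Injective w) (a : Fin h) (D : Finset (Fin h)) (Sx τ : Fin h → Finset (Fin h))
    (hD : ∀ c ∈ D, a ∉ Sx c) (hτ : ∀ c ∈ D, c ∈ τ c) (hinj : ∀ c ∈ D, ∀ c' ∈ D, Sx c = Sx c' → c = c')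
    (hrow : ∀ i, a ∈ u i → ∃ c ∈ D, Sx c = (u i).erase a ∧ τ c = w i)
    (hD₀ : (Matrix.of fun i j : {i : Fin r // a ∉ u i} =>
      coeff (pexpo (u i.1) (w j.1)) (symbolicWitness s h)).det ≠ 0) :
    symbolicDet s h r u w ≠ 0 := by
  classical
  -- the specialised layout matrix, scale `N = h`
  obtain ⟨L', hL'⟩ : ∃ L' : Matrix (Fin r) (Fin r) (Polynomial (MvPolynomial (Param h) ℂ)),
      L' = Matrix.of fun i j : Fin r =>
        coeff (pexpo (u i) (w j)) (MvPolynomial.map (thinHom a D Sx τ h) (symbolicWitness s h)) := ⟨_, rfl⟩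
  -- row degrees
  let d : Fin r → ℕ := fun i => if a ∈ u i then topExp h h ((u i).erase a).card (w i).card else 0
  have hlink : ∀ i j, a ∈ u i → L' i j = linkEntry a D Sx τ h s (u i) (w j) := by
    intro i j hi
    rw [hL', Matrix.of_apply, coeff_map_thinHom_eq_linkEntry a D Sx τ h hs hD (w j) hi]
  have hdel : ∀ i j, a ∉ u i → L' i j = Polynomial.C (coeff (pexpo (u i) (w j)) (symbolicWitness s h)) := by
    intro i j hi
    rw [hL', Matrix.of_apply, coeff_map_thinHom_of_not_mem a D Sx τ h hs hD (w j) hi]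
  have hdeg : ∀ i j, (L' i j).natDegree ≤ d i := by
    intro i j
    by_cases hi : a ∈ u i
    · obtain ⟨c₀, hc₀, hSx, hτ₀⟩ := hrow i hi
      simp only [d, if_pos hi]
      rw [hlink i j hi, ← hτ₀]
      exact natDegree_linkEntry_le s le_rfl hinj hτ hc₀ hSx (w j)
    · simp only [d, if_neg hi]
      rw [hdel i j hi, Polynomial.natDegree_C]
  -- the top-coefficient matrix
  have htop : (Matrix.of fun i j => (L' i j).coeff (d i)) =
      Matrix.of fun i j : Fin r => if a ∈ u i then (if j = i then (1 : MvPolynomial (Param h) ℂ) else 0)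
        else coeff (pexpo (u i) (w j)) (symbolicWitness s h) := by
    ext i j
    rw [Matrix.of_apply, Matrix.of_apply]
    by_cases hi : a ∈ u i
    · obtain ⟨c₀, hc₀, hSx, hτ₀⟩ := hrow i hi
      simp only [d, if_pos hi]
      rw [hlink i j hi, ← hτ₀, coeff_linkEntry_top s le_rfl hinj hτ hc₀ hSx (w j), hτ₀]
      by_cases hji : j = i
      · rw [if_pos hji, if_pos (by rw [hji])]
      · rw [if_neg hji, if_neg (fun heq => hji (hw heq))]
    · simp only [d, if_neg hi]
      rw [hdel i j hi, Polynomial.coeff_C_zero]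
  -- block triangularity
  have hblock := Matrix.twoBlockTriangular_det'
    (Matrix.of fun i j : Fin r => if a ∈ u i then (if j = i then (1 : MvPolynomial (Param h) ℂ) else 0)
      else coeff (pexpo (u i) (w j)) (symbolicWitness s h))
    (fun i => a ∈ u i) (fun i hi j hj => by
      rw [Matrix.of_apply, if_pos hi, if_neg]
      rintro rfl
      exact hj hi)
  have hB₁ : Matrix.toSquareBlockProp
      (Matrix.of fun i j : Fin r => if a ∈ u i then (if j = i then (1 : MvPolynomial (Param h) ℂ) else 0)
        else coeff (pexpo (u i) (w j)) (symbolicWitness s h))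
      (fun i => a ∈ u i) = 1 := by
    ext i j
    simp only [Matrix.toSquareBlockProp_def, Matrix.of_apply, if_pos i.2, Matrix.one_apply]
    by_cases hij : i = j
    · rw [if_pos hij, if_pos (by rw [hij])]
    · rw [if_neg hij, if_neg (fun hji => hij (Subtype.ext hji.symm))]
  have hB₀ : Matrix.toSquareBlockProp
      (Matrix.of fun i j : Fin r => if a ∈ u i then (if j = i then (1 : MvPolynomial (Param h) ℂ) else 0)
        else coeff (pexpo (u i) (w j)) (symbolicWitness s h))
      (fun i => ¬ a ∈ u i) =
      Matrix.of fun i j : {i : Fin r // a ∉ u i} => coeff (pexpo (u i.1) (w j.1)) (symbolicWitness s h) := by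
    funext i j
    simp only [Matrix.toSquareBlockProp_def, Matrix.of_apply, if_neg i.2]
  -- conclusion
  intro hzero
  have hcoeff := coeff_det_of_natDegree_le_row L' d hdeg
  rw [htop, hblock, hB₁, hB₀, Matrix.det_one, one_mul, hL', det_thinLayout, hzero, map_zero, Polynomial.coeff_zero] at hcoeff
  exact hD₀ hcoeff.symm

end ThinStep

end

end Summit.ValiantsHypothesis.ValiantsHypothesis.Theorems.BarrierLever.AnchoredPeeling
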